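/-
Copyright: cell `pub-balaban-gaps` (G2), seat ne6 (row NE7b), `prover-pub-balaban-gaps-ne6-g17-0`. Project licence.
-/
import Summits.QuantumFields.BalabanUV.T4Continuum.Spine.NE7b.CompactFibreSU2ClassIntegral
import Summits.QuantumFields.BalabanUV.T4Continuum.Spine.NE7b.CompactFibreWindowSU2DoublingHaar
import Mathlib.Analysis.Calculus.ParametricIntegral
import Mathlib.MeasureTheory.Integral.IntervalIntegral.IntegrationByParts
import Mathlib.Analysis.Calculus.Deriv.MeanValue
import Mathlib.Analysis.SpecialFunctions.Sqrt
import Mathlib.Analysis.SpecialFunctions.Integrals.Basic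

/-!
# THE SCALED ONE-PLAQUETTE MASS `β^{3∕2}·Z_{SU(2)}(β)` IS STRICTLY INCREASING, WITH THE DEFECT IDENTITY
# `(β^{3∕2}Z)′(β) = (√β∕π)·∫₀^π e^{−2β(1−cos ψ)}(1 − cos ψ)² dψ`, AND THE TANGENT FLOOR `Z_{SU(2)}(β) ≥ e^{−2β}`
# (row NE7b, node U5c; MODEL, [folklore]; census V44 — the refuter's request line «certify `f(β) = Z_N(β)·β^{(N²−1)∕2}` non-decreasing», N = 2, by calculus)

Cell `pub-balaban-gaps` (G2 spine census) for the `pub-balaban` T⁴ crux NE7b (`T4WeightBudget.RelWeightBound`; NOT PRINTED, NOT PROVED).  Crux-route work under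
`Spine/NE7b/`; imports the landed V40e `CompactFibreSU2ClassIntegral` (Weyl's integration formula, `integral_exp_neg_traceDeficit_eq`) and J1
`CompactFibreWindowSU2DoublingHaar` (`re_trace_one_sub_eq`, `abs_re_trace_le_two`) + Mathlib (parametric differentiation, integration by parts, mean value);
no `def`, zero `sorry`, nothing of Bałaban's asserted.

THE LOCATED QUESTION.  Refuter NE7bREF-G99-POST3 (ii) (journal l.60821), instrument no. 7: «the clean statement behind D_true = 1 is the monotonicity of
`β ↦ Z(β)·β^{(N²−1)∕2}` (equivalently: the one-plaquette Wilson weight's Laplace transform decays no faster than its Gaussian limit at every finite β) —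
request line: certify `f(β) = Z_N(β)·β^{(N²−1)∕2}` non-decreasing on `β ≥ 0` for N = 2, 3».  For N = 2 the NON-STRICT statement is already junction J2's
`CompactFibreHalvedActionSU2Sharp.halvedAction_moment_le_sharp` (`Z((1−δ)β) ≤ (1−δ)^{−3∕2}·Z(β)`, by window doubling with D = 1).  QUESTION (V44): is `f`
STRICTLY increasing, what is `f′` exactly, and what floor does the small-β end give by value?  ANSWER ([folklore]; `s = Re tr(1 − V)`,
`Z(β) = ∫ e^{−βs} dHaar_{SU(2)} = (2∕π)·G(β)`, `G(β) = ∫_{(0,π)} e^{−2β(1−cos ψ)} sin²ψ dψ`):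
* §1–§2 **`hasDerivAt_weylIntegral`**: `G′(β) = ∫ −2(1−cos ψ)·e^{−2β(1−cos ψ)} sin²ψ dψ` (differentiation under the integral, every real β);
* §3 **`weylIntegral_parts`**: `∫ e^{−2β(1−cos ψ)}(sin²ψ + (1 − cos ψ)cos ψ) dψ = 2β·∫ e^{−2β(1−cos ψ)}(1 − cos ψ) sin²ψ dψ` (parts against `(1 − cos ψ) sin ψ`);
* §4 **`weylIntegral_defect_identity`**: `(3∕2)·G(β) + β·G′(β) = ½·∫ e^{−2β(1−cos ψ)}(1 − cos ψ)² dψ` — the defect is HALF THE SECOND MOMENT OF THE DEFICIT;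
* §5 **`hasDerivAt_scaled_weylIntegral`** (`β > 0`): `((√β)³·G)′(β) = (√β∕2)·∫ e^{−2β(1−cos ψ)}(1 − cos ψ)² dψ > 0`; **`scaled_weylIntegral_strictMonoOn`** on `[0, ∞)`;
* §6 (Haar currency, via V40e) **`hasDerivAt_scaled_plaquetteMass_SU2`** (`f′(β) = (√β∕π)·∫₀^π e^{−2β(1−cos ψ)}(1 − cos ψ)² dψ`),
  **`scaled_plaquetteMass_SU2_strictMonoOn`** ∕ `…_monotoneOn` (`f(β) = (√β)³·Z(β)` STRICTLY increasing on `[0, ∞)`), `scaled_plaquetteMass_SU2_le` (pair form);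
* §8 **`mean_action_lt_equipartition`** (`β > 0`): `β·∫ s·e^{−βs} dHaar < (3∕2)·Z(β)` — under the one-plaquette Wilson weight the MEAN ACTION `⟨s⟩_β` is STRICTLY
  BELOW its Gaussian equipartition value `dim SU(2)∕(2β) = 3∕(2β)` at every coupling (the same defect; `integral_traceDeficit_mul_exp_eq` is the Weyl form of the first moment);
* §7 **`exp_neg_two_mul_le_plaquetteMass_SU2`**: `e^{−2β} ≤ Z(β)` for every `β ≥ 0` (tangent line `e^{2β cos ψ} ≥ 1 + 2β cos ψ`, `∫₀^π sin² = π∕2`,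
  `∫₀^π sin²ψ cos ψ dψ = 0` — the Boltzmann factor of the MEAN action `⟨s⟩_Haar = 2`), and with §6 **`tangentFloor_le_plaquetteMass_SU2`**:
  `(3√3∕8)·e^{−3∕2}·((√β)⁻¹)³ ≤ Z(β)` for `β ≥ 3∕4` (`0.14493·β^{−3∕2}`; V41's Markov floor was `e⁻¹∕8 = 0.04599`, truth `(2√π)⁻¹ = 0.28209` asymptotically).

HONEST REMARKS.  (i) MODEL ∕ [folklore]: Haar calculus of ONE `SU(2)` plaquette variable; nothing of the interacting measure (leaf-06's `LocalPlaquetteExpMoments`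
family is the letter there).  (ii) N = 2 only: N = 3 needs the rank-2 Weyl formula (absent in Mathlib and the tree); not treated.  (iii) The ceiling half (`f(β) ↑ (2√π)⁻¹`,
hence `Z(β) ≤ (2√π)⁻¹β^{−3∕2}` sharp) is the sibling V45 + junction J3, not this file.  (iv) (A3) ∕ (A1c) NOT asserted; NC-NE7b-α UNRULED.  BY-NAME EFFECT ON THE WALL:
NONE.  NE7b NOT PRINTED ∕ NOT PROVED; spine PROVED 0∕9; rung (B)+1 on ONE finite T⁴ — NOT infinite volume, NOT the mass gap, NOT Clay.
HONEST DEPENDENCY: continuum YM on T⁴ ⇐ BetaPertH ∧ nine spine estimates (0/9 proved); BetaPertH ⇐ (D1) ∧ (D4) ∧ CAP+tail;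
G-an2-4 gates asym, D1 and NE2/3/4.  This file changes none of it.
-/

set_option autoImplicit false

noncomputable section

open Real Set MeasureTheory Filter Topology
open Literature.MathematicalPhysics.QuantumFieldTheory (haarProbability)
open Summit.QuantumFields.BalabanUV.T4Continuum.NE7b.CompactFibreWindowSU2DoublingHaar (re_trace_one_sub_eq abs_re_trace_le_two)
open Summit.QuantumFields.BalabanUV.T4Continuum.NE7b.CompactFibreSU2ClassIntegral (integral_exp_neg_traceDeficit_eq integral_haar_su2_classFun)

namespace Summit.QuantumFields.BalabanUV.T4Continuum.NE7b.CompactFibrePlaquetteMassSU2Monotone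

/-! ### §1 Pointwise calculus of the Weyl weight `e^{−2β(1−cos ψ)}` -/
/-- `∂_β e^{−2β(1−cos ψ)} = −2(1 − cos ψ)·e^{−2β(1−cos ψ)}`. [folklore] -/
theorem hasDerivAt_weylWeight (β ψ : ℝ) :
    HasDerivAt (fun b : ℝ => Real.exp (-(2 * b * (1 - Real.cos ψ)))) (-(2 * (1 - Real.cos ψ)) * Real.exp (-(2 * β * (1 - Real.cos ψ)))) β := by
  have h : HasDerivAt (fun b : ℝ => -(2 * b * (1 - Real.cos ψ))) (-(2 * 1 * (1 - Real.cos ψ))) β :=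
    (((hasDerivAt_id β).const_mul 2).mul_const (1 - Real.cos ψ)).neg
  exact h.exp.congr_deriv (by ring)
/-- `∂_ψ e^{−2β(1−cos ψ)} = −2β sin ψ·e^{−2β(1−cos ψ)}`. [folklore] -/
theorem hasDerivAt_weylWeight_angle (β ψ : ℝ) :
    HasDerivAt (fun x : ℝ => Real.exp (-(2 * β * (1 - Real.cos x)))) (Real.exp (-(2 * β * (1 - Real.cos ψ))) * (-(2 * β * Real.sin ψ))) ψ := by
  have h1 : HasDerivAt (fun x : ℝ => 1 - Real.cos x) (Real.sin ψ) ψ := by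
    have := (hasDerivAt_const ψ (1 : ℝ)).sub (Real.hasDerivAt_cos ψ)
    exact this.congr_deriv (by ring)
  have h : HasDerivAt (fun x : ℝ => -(2 * β * (1 - Real.cos x))) (-(2 * β * Real.sin ψ)) ψ := (h1.const_mul (2 * β)).neg
  exact h.exp
/-- The weight is at most `e^{4|β|}` (`0 ≤ 1 − cos ψ ≤ 2`). [folklore] -/
theorem weylWeight_le (β ψ : ℝ) : Real.exp (-(2 * β * (1 - Real.cos ψ))) ≤ Real.exp (4 * |β|) := by
  refine Real.exp_le_exp.2 ?_
  have h1 : 0 ≤ 1 - Real.cos ψ := by linarith [Real.cos_le_one ψ]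
  have h2 : 1 - Real.cos ψ ≤ 2 := by linarith [Real.neg_one_le_cos ψ]
  have : -(2 * β * (1 - Real.cos ψ)) ≤ |2 * β * (1 - Real.cos ψ)| := neg_le_abs _
  rw [abs_mul, abs_mul, abs_of_nonneg h1, abs_two] at this
  nlinarith [abs_nonneg β]

/-! ### §2 Differentiation under the integral sign -/
/-- **`G′(β)`**: `β ↦ ∫_{(0,π)} e^{−2β(1−cos ψ)} sin²ψ dψ` has derivative `∫_{(0,π)} −2(1−cos ψ)·e^{−2β(1−cos ψ)} sin²ψ dψ` at every real `β`. [folklore] -/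
theorem hasDerivAt_weylIntegral (β : ℝ) :
    HasDerivAt (fun b : ℝ => ∫ ψ in Set.Ioo 0 Real.pi, Real.exp (-(2 * b * (1 - Real.cos ψ))) * Real.sin ψ ^ 2)
      (∫ ψ in Set.Ioo 0 Real.pi, -(2 * (1 - Real.cos ψ)) * Real.exp (-(2 * β * (1 - Real.cos ψ))) * Real.sin ψ ^ 2) β := by
  have hs : Set.Ioo (β - 1) (β + 1) ∈ 𝓝 β := Ioo_mem_nhds (by linarith) (by linarith)
  have hFc : ∀ b : ℝ, Continuous fun ψ : ℝ => Real.exp (-(2 * b * (1 - Real.cos ψ))) * Real.sin ψ ^ 2 := fun b => by fun_prop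
  have hF'c : ∀ b : ℝ, Continuous fun ψ : ℝ => -(2 * (1 - Real.cos ψ)) * Real.exp (-(2 * b * (1 - Real.cos ψ))) * Real.sin ψ ^ 2 := fun b => by fun_prop
  have hF_meas : ∀ᶠ b in 𝓝 β, AEStronglyMeasurable (fun ψ : ℝ => Real.exp (-(2 * b * (1 - Real.cos ψ))) * Real.sin ψ ^ 2) (volume.restrict (Set.Ioo 0 Real.pi)) :=
    Filter.Eventually.of_forall fun b => (hFc b).aestronglyMeasurable
  have hF_int : Integrable (fun ψ : ℝ => Real.exp (-(2 * β * (1 - Real.cos ψ))) * Real.sin ψ ^ 2) (volume.restrict (Set.Ioo 0 Real.pi)) :=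
    ((hFc β).integrableOn_Icc).mono_set Set.Ioo_subset_Icc_self
  have hF'_meas : AEStronglyMeasurable (fun ψ : ℝ => -(2 * (1 - Real.cos ψ)) * Real.exp (-(2 * β * (1 - Real.cos ψ))) * Real.sin ψ ^ 2)
      (volume.restrict (Set.Ioo 0 Real.pi)) := (hF'c β).aestronglyMeasurable
  have h_bound : ∀ᵐ ψ ∂(volume.restrict (Set.Ioo 0 Real.pi)), ∀ b ∈ Set.Ioo (β - 1) (β + 1),
      ‖-(2 * (1 - Real.cos ψ)) * Real.exp (-(2 * b * (1 - Real.cos ψ))) * Real.sin ψ ^ 2‖ ≤ 4 * Real.exp (4 * (|β| + 1)) :=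
    ae_of_all _ fun ψ b hb => by
      have h1 : 0 ≤ 1 - Real.cos ψ := by linarith [Real.cos_le_one ψ]
      have h2 : 1 - Real.cos ψ ≤ 2 := by linarith [Real.neg_one_le_cos ψ]
      have hw := weylWeight_le b ψ
      have hb' : |b| ≤ |β| + 1 := by
        have := abs_sub_abs_le_abs_sub b β
        have : |b - β| ≤ 1 := abs_le.2 ⟨by linarith [hb.1], by linarith [hb.2]⟩
        linarith
      have hw' : Real.exp (-(2 * b * (1 - Real.cos ψ))) ≤ Real.exp (4 * (|β| + 1)) := hw.trans (Real.exp_le_exp.2 (by linarith))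
      rw [Real.norm_eq_abs, abs_mul, abs_mul, abs_neg, abs_mul, abs_two, abs_of_nonneg h1, abs_of_pos (Real.exp_pos _), abs_of_nonneg (sq_nonneg _)]
      have hs1 : Real.sin ψ ^ 2 ≤ 1 := Real.sin_sq_le_one ψ
      calc 2 * (1 - Real.cos ψ) * Real.exp (-(2 * b * (1 - Real.cos ψ))) * Real.sin ψ ^ 2
          ≤ 2 * 2 * Real.exp (4 * (|β| + 1)) * 1 := by
            gcongr
        _ = 4 * Real.exp (4 * (|β| + 1)) := by ring
  have h_diff : ∀ᵐ ψ ∂(volume.restrict (Set.Ioo 0 Real.pi)), ∀ b ∈ Set.Ioo (β - 1) (β + 1),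
      HasDerivAt (fun b : ℝ => Real.exp (-(2 * b * (1 - Real.cos ψ))) * Real.sin ψ ^ 2)
        (-(2 * (1 - Real.cos ψ)) * Real.exp (-(2 * b * (1 - Real.cos ψ))) * Real.sin ψ ^ 2) b :=
    ae_of_all _ fun ψ b _ => (hasDerivAt_weylWeight b ψ).mul_const _
  exact (hasDerivAt_integral_of_dominated_loc_of_deriv_le hs hF_meas hF_int hF'_meas h_bound (integrable_const _) h_diff).2
/-- `G` is continuous (indeed differentiable) on `ℝ`. [folklore] -/
theorem continuous_weylIntegral :
    Continuous fun b : ℝ => ∫ ψ in Set.Ioo 0 Real.pi, Real.exp (-(2 * b * (1 - Real.cos ψ))) * Real.sin ψ ^ 2 :=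
  continuous_iff_continuousAt.2 fun b => (hasDerivAt_weylIntegral b).continuousAt

/-! ### §3 Integration by parts in Weyl's variable -/
/-- Set integrals over `(0, π)` are interval integrals. -/
theorem setIntegral_Ioo_eq_intervalIntegral (f : ℝ → ℝ) :
    ∫ ψ in Set.Ioo 0 Real.pi, f ψ = ∫ ψ in (0 : ℝ)..Real.pi, f ψ := by
  rw [intervalIntegral.integral_of_le Real.pi_pos.le, integral_Ioc_eq_integral_Ioo]
/-- **INTEGRATION BY PARTS**: `∫₀^π e^{−2β(1−cos ψ)}·(sin²ψ + (1 − cos ψ)cos ψ) dψ = 2β·∫₀^π e^{−2β(1−cos ψ)}·(1 − cos ψ)·sin²ψ dψ`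
(`u = e^{−2β(1−cos ψ)}`, `v = (1 − cos ψ) sin ψ`, `v(0) = v(π) = 0`, `v′ = sin²ψ + (1 − cos ψ)cos ψ`, `u′ = −2β sin ψ·u`). [folklore] -/
theorem weylIntegral_parts (β : ℝ) :
    ∫ ψ in Set.Ioo 0 Real.pi, Real.exp (-(2 * β * (1 - Real.cos ψ))) * (Real.sin ψ ^ 2 + (1 - Real.cos ψ) * Real.cos ψ)
      = 2 * β * ∫ ψ in Set.Ioo 0 Real.pi, Real.exp (-(2 * β * (1 - Real.cos ψ))) * (1 - Real.cos ψ) * Real.sin ψ ^ 2 := by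
  rw [setIntegral_Ioo_eq_intervalIntegral, setIntegral_Ioo_eq_intervalIntegral]
  have hu : ∀ x ∈ Set.uIcc (0 : ℝ) Real.pi, HasDerivAt (fun x : ℝ => Real.exp (-(2 * β * (1 - Real.cos x))))
      (Real.exp (-(2 * β * (1 - Real.cos x))) * (-(2 * β * Real.sin x))) x := fun x _ => hasDerivAt_weylWeight_angle β x
  have hv : ∀ x ∈ Set.uIcc (0 : ℝ) Real.pi, HasDerivAt (fun x : ℝ => (1 - Real.cos x) * Real.sin x)
      (Real.sin x * Real.sin x + (1 - Real.cos x) * Real.cos x) x := fun x _ => by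
    have h1 : HasDerivAt (fun x : ℝ => 1 - Real.cos x) (Real.sin x) x :=
      ((hasDerivAt_const x (1 : ℝ)).sub (Real.hasDerivAt_cos x)).congr_deriv (by ring)
    exact h1.mul (Real.hasDerivAt_sin x)
  have hu' : IntervalIntegrable (fun x : ℝ => Real.exp (-(2 * β * (1 - Real.cos x))) * (-(2 * β * Real.sin x))) volume 0 Real.pi :=
    (by fun_prop : Continuous fun x : ℝ => Real.exp (-(2 * β * (1 - Real.cos x))) * (-(2 * β * Real.sin x))).intervalIntegrable _ _
  have hv' : IntervalIntegrable (fun x : ℝ => Real.sin x * Real.sin x + (1 - Real.cos x) * Real.cos x) volume 0 Real.pi :=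
    (by fun_prop : Continuous fun x : ℝ => Real.sin x * Real.sin x + (1 - Real.cos x) * Real.cos x).intervalIntegrable _ _
  have hparts := intervalIntegral.integral_mul_deriv_eq_deriv_mul hu hv hu' hv'
  simp only [Real.sin_pi, Real.sin_zero, mul_zero, sub_zero, zero_sub] at hparts
  have hL : ∫ x in (0 : ℝ)..Real.pi, Real.exp (-(2 * β * (1 - Real.cos x))) * (Real.sin x ^ 2 + (1 - Real.cos x) * Real.cos x)
      = ∫ x in (0 : ℝ)..Real.pi, Real.exp (-(2 * β * (1 - Real.cos x))) * (Real.sin x * Real.sin x + (1 - Real.cos x) * Real.cos x) :=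
    intervalIntegral.integral_congr fun x _ => by simp only [sq]
  have hR : ∫ x in (0 : ℝ)..Real.pi, Real.exp (-(2 * β * (1 - Real.cos x))) * (-(2 * β * Real.sin x)) * ((1 - Real.cos x) * Real.sin x)
      = -(2 * β) * ∫ x in (0 : ℝ)..Real.pi, Real.exp (-(2 * β * (1 - Real.cos x))) * (1 - Real.cos x) * Real.sin x ^ 2 := by
    rw [← intervalIntegral.integral_const_mul]
    exact intervalIntegral.integral_congr fun x _ => by simp only [sq]; ring
  rw [hL, hparts, hR]
  ring

/-! ### §4 The defect identity -/
/-- **THE DEFECT IDENTITY**: `(3∕2)·G(β) + β·G′(β) = ½·∫₀^π e^{−2β(1−cos ψ)}(1 − cos ψ)² dψ` — with `sin² = 1 − cos²`,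
`(3∕2)sin² − (sin² + (1−cos)cos) = ½(1 − cos)²` pointwise after §3. [folklore] -/
theorem weylIntegral_defect_identity (β : ℝ) :
    3 / 2 * (∫ ψ in Set.Ioo 0 Real.pi, Real.exp (-(2 * β * (1 - Real.cos ψ))) * Real.sin ψ ^ 2)
      + β * (∫ ψ in Set.Ioo 0 Real.pi, -(2 * (1 - Real.cos ψ)) * Real.exp (-(2 * β * (1 - Real.cos ψ))) * Real.sin ψ ^ 2)
      = 1 / 2 * ∫ ψ in Set.Ioo 0 Real.pi, Real.exp (-(2 * β * (1 - Real.cos ψ))) * (1 - Real.cos ψ) ^ 2 := by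
  have hIoo : ∀ {g : ℝ → ℝ}, Continuous g → Integrable g (volume.restrict (Set.Ioo 0 Real.pi)) := fun hg =>
    (hg.integrableOn_Icc).mono_set Set.Ioo_subset_Icc_self
  -- `β·G′ = −(IBP left side)`
  have hB : β * (∫ ψ in Set.Ioo 0 Real.pi, -(2 * (1 - Real.cos ψ)) * Real.exp (-(2 * β * (1 - Real.cos ψ))) * Real.sin ψ ^ 2)
      = -(∫ ψ in Set.Ioo 0 Real.pi, Real.exp (-(2 * β * (1 - Real.cos ψ))) * (Real.sin ψ ^ 2 + (1 - Real.cos ψ) * Real.cos ψ)) := by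
    rw [weylIntegral_parts, ← integral_const_mul, ← integral_const_mul, ← integral_neg]
    refine integral_congr_ae (ae_of_all _ fun ψ => ?_)
    ring
  rw [hB, ← integral_const_mul, ← sub_eq_add_neg, ← integral_sub ((hIoo (by fun_prop)).const_mul _ |>.congr (ae_of_all _ fun _ => rfl)) (hIoo (by fun_prop)),
    ← integral_const_mul]
  · refine integral_congr_ae (ae_of_all _ fun ψ => ?_)
    have hs : Real.sin ψ ^ 2 = 1 - Real.cos ψ ^ 2 := Real.sin_sq ψ
    simp only [hs]
    ring

/-! ### §5 The scaled integral `(√β)³·G(β)` is strictly increasing -/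
/-- **`((√β)³·G)′(β) = (√β∕2)·∫₀^π e^{−2β(1−cos ψ)}(1 − cos ψ)² dψ`** for `β > 0`. [folklore] -/
theorem hasDerivAt_scaled_weylIntegral {β : ℝ} (hβ : 0 < β) :
    HasDerivAt (fun b : ℝ => Real.sqrt b ^ 3 * ∫ ψ in Set.Ioo 0 Real.pi, Real.exp (-(2 * b * (1 - Real.cos ψ))) * Real.sin ψ ^ 2)
      (Real.sqrt β / 2 * ∫ ψ in Set.Ioo 0 Real.pi, Real.exp (-(2 * β * (1 - Real.cos ψ))) * (1 - Real.cos ψ) ^ 2) β := by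
  have hsβ : 0 < Real.sqrt β := Real.sqrt_pos.2 hβ
  have hsq : Real.sqrt β ^ 2 = β := Real.sq_sqrt hβ.le
  have hss : Real.sqrt β * Real.sqrt β = β := Real.mul_self_sqrt hβ.le
  have hsd : HasDerivAt (fun x : ℝ => Real.sqrt x ^ 3) (3 / 2 * Real.sqrt β) β := by
    refine ((Real.hasDerivAt_sqrt hβ.ne').pow 3).congr_deriv ?_
    push_cast
    rw [hsq]
    field_simp
    nlinarith [hss, hsq]
  have hprod := hsd.mul (hasDerivAt_weylIntegral β)
  refine hprod.congr_deriv ?_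
  have hid := weylIntegral_defect_identity β
  have e3 : Real.sqrt β ^ 3 = Real.sqrt β * β := by rw [pow_succ, hsq, mul_comm]
  rw [e3]
  have : 3 / 2 * Real.sqrt β * (∫ ψ in Set.Ioo 0 Real.pi, Real.exp (-(2 * β * (1 - Real.cos ψ))) * Real.sin ψ ^ 2)
      + Real.sqrt β * β * (∫ ψ in Set.Ioo 0 Real.pi, -(2 * (1 - Real.cos ψ)) * Real.exp (-(2 * β * (1 - Real.cos ψ))) * Real.sin ψ ^ 2)
      = Real.sqrt β * (3 / 2 * (∫ ψ in Set.Ioo 0 Real.pi, Real.exp (-(2 * β * (1 - Real.cos ψ))) * Real.sin ψ ^ 2)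
        + β * (∫ ψ in Set.Ioo 0 Real.pi, -(2 * (1 - Real.cos ψ)) * Real.exp (-(2 * β * (1 - Real.cos ψ))) * Real.sin ψ ^ 2)) := by ring
  rw [this, hid]
  ring
/-- The second moment of the deficit is positive: `0 < ∫₀^π e^{−2β(1−cos ψ)}(1 − cos ψ)² dψ`. [folklore] -/
theorem deficitMoment_pos (β : ℝ) :
    0 < ∫ ψ in Set.Ioo 0 Real.pi, Real.exp (-(2 * β * (1 - Real.cos ψ))) * (1 - Real.cos ψ) ^ 2 := by
  rw [setIntegral_Ioo_eq_intervalIntegral]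
  refine intervalIntegral.intervalIntegral_pos_of_pos_on
    ((by fun_prop : Continuous fun ψ : ℝ => Real.exp (-(2 * β * (1 - Real.cos ψ))) * (1 - Real.cos ψ) ^ 2).intervalIntegrable _ _)
    (fun ψ hψ => mul_pos (Real.exp_pos _) (pow_pos ?_ 2)) Real.pi_pos
  have hne : Real.cos ψ ≠ 1 := fun h => by
    have := (Real.cos_eq_one_iff_of_lt_of_lt (by linarith [hψ.1, Real.pi_pos]) (by linarith [hψ.2, Real.pi_pos])).1 h
    linarith [hψ.1]
  exact sub_pos.2 (lt_of_le_of_ne (Real.cos_le_one ψ) hne)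
/-- **`β ↦ (√β)³·G(β)` IS STRICTLY INCREASING ON `[0, ∞)`**. [folklore] -/
theorem scaled_weylIntegral_strictMonoOn :
    StrictMonoOn (fun b : ℝ => Real.sqrt b ^ 3 * ∫ ψ in Set.Ioo 0 Real.pi, Real.exp (-(2 * b * (1 - Real.cos ψ))) * Real.sin ψ ^ 2) (Set.Ici 0) := by
  refine strictMonoOn_of_deriv_pos (convex_Ici 0) ?_ fun x hx => ?_
  · exact ((Real.continuous_sqrt.pow 3).mul continuous_weylIntegral).continuousOn
  · rw [interior_Ici] at hx
    have hx' : 0 < x := hx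
    rw [(hasDerivAt_scaled_weylIntegral hx').deriv]
    have hsx : 0 < Real.sqrt x := Real.sqrt_pos.2 hx'
    exact mul_pos (by positivity) (deficitMoment_pos x)

/-! ### §6 Haar currency: `f(β) = (√β)³·Z_{SU(2)}(β)` -/
/-- **THE DEFECT IDENTITY IN HAAR CURRENCY**: for `β > 0`,
`((√β)³·∫ e^{−β·Re tr(1−U)} dHaar_{SU(2)})′ = (√β∕π)·∫₀^π e^{−2β(1−cos ψ)}(1 − cos ψ)² dψ` (`> 0`). [folklore] -/
theorem hasDerivAt_scaled_plaquetteMass_SU2 {β : ℝ} (hβ : 0 < β) :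
    HasDerivAt (fun b : ℝ => Real.sqrt b ^ 3 *
        ∫ U, Real.exp (-(b * (Matrix.trace (1 - (U : Matrix (Fin 2) (Fin 2) ℂ))).re)) ∂(haarProbability (Matrix.specialUnitaryGroup (Fin 2) ℂ)))
      (Real.sqrt β / Real.pi * ∫ ψ in Set.Ioo 0 Real.pi, Real.exp (-(2 * β * (1 - Real.cos ψ))) * (1 - Real.cos ψ) ^ 2) β := by
  have hev : (fun b : ℝ => Real.sqrt b ^ 3 * (2 / Real.pi * ∫ ψ in Set.Ioo 0 Real.pi, Real.exp (-(2 * b * (1 - Real.cos ψ))) * Real.sin ψ ^ 2))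
      =ᶠ[𝓝 β] (fun b : ℝ => Real.sqrt b ^ 3 *
        ∫ U, Real.exp (-(b * (Matrix.trace (1 - (U : Matrix (Fin 2) (Fin 2) ℂ))).re)) ∂(haarProbability (Matrix.specialUnitaryGroup (Fin 2) ℂ))) := by
    filter_upwards [Ioi_mem_nhds hβ] with b hb
    rw [integral_exp_neg_traceDeficit_eq (le_of_lt hb)]
  have h := (hasDerivAt_scaled_weylIntegral hβ).const_mul (2 / Real.pi)
  have h' : HasDerivAt (fun b : ℝ => Real.sqrt b ^ 3 * (2 / Real.pi * ∫ ψ in Set.Ioo 0 Real.pi, Real.exp (-(2 * b * (1 - Real.cos ψ))) * Real.sin ψ ^ 2))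
      (Real.sqrt β / Real.pi * ∫ ψ in Set.Ioo 0 Real.pi, Real.exp (-(2 * β * (1 - Real.cos ψ))) * (1 - Real.cos ψ) ^ 2) β := by
    refine (h.congr_deriv ?_).congr_of_eventuallyEq (Filter.Eventually.of_forall fun b => by ring)
    ring
  exact h'.congr_of_eventuallyEq hev.symm
/-- **`f(β) = (√β)³·Z_{SU(2)}(β)` IS STRICTLY INCREASING ON `[0, ∞)`** — the refuter's request line (NE7bREF-G99-POST3 (ii)) for N = 2, strict form. [folklore] -/
theorem scaled_plaquetteMass_SU2_strictMonoOn :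
    StrictMonoOn (fun β : ℝ => Real.sqrt β ^ 3 *
        ∫ U, Real.exp (-(β * (Matrix.trace (1 - (U : Matrix (Fin 2) (Fin 2) ℂ))).re)) ∂(haarProbability (Matrix.specialUnitaryGroup (Fin 2) ℂ)))
      (Set.Ici 0) := by
  intro a ha b hb hab
  have h := scaled_weylIntegral_strictMonoOn ha hb hab
  simp only at h ⊢
  rw [integral_exp_neg_traceDeficit_eq (Set.mem_Ici.1 ha), integral_exp_neg_traceDeficit_eq (Set.mem_Ici.1 hb), ← mul_assoc, ← mul_assoc,
    mul_comm (Real.sqrt a ^ 3), mul_comm (Real.sqrt b ^ 3), mul_assoc, mul_assoc]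
  exact mul_lt_mul_of_pos_left h (by positivity)
/-- `f` is non-decreasing on `[0, ∞)` (the NON-strict form is also J2's `halvedAction_moment_le_sharp` read with `δ = 1 − β₁∕β₂`). [folklore] -/
theorem scaled_plaquetteMass_SU2_monotoneOn :
    MonotoneOn (fun β : ℝ => Real.sqrt β ^ 3 *
        ∫ U, Real.exp (-(β * (Matrix.trace (1 - (U : Matrix (Fin 2) (Fin 2) ℂ))).re)) ∂(haarProbability (Matrix.specialUnitaryGroup (Fin 2) ℂ)))
      (Set.Ici 0) :=
  scaled_plaquetteMass_SU2_strictMonoOn.monotoneOn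
/-- Pair form: for `0 ≤ β₁ ≤ β₂`, `(√β₁)³·Z(β₁) ≤ (√β₂)³·Z(β₂)`. [folklore] -/
theorem scaled_plaquetteMass_SU2_le {β₁ β₂ : ℝ} (h₁ : 0 ≤ β₁) (h : β₁ ≤ β₂) :
    Real.sqrt β₁ ^ 3 * ∫ U, Real.exp (-(β₁ * (Matrix.trace (1 - (U : Matrix (Fin 2) (Fin 2) ℂ))).re)) ∂(haarProbability (Matrix.specialUnitaryGroup (Fin 2) ℂ))
      ≤ Real.sqrt β₂ ^ 3 * ∫ U, Real.exp (-(β₂ * (Matrix.trace (1 - (U : Matrix (Fin 2) (Fin 2) ℂ))).re)) ∂(haarProbability (Matrix.specialUnitaryGroup (Fin 2) ℂ)) :=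
  scaled_plaquetteMass_SU2_monotoneOn (Set.mem_Ici.2 h₁) (Set.mem_Ici.2 (h₁.trans h)) h
/-- Strict pair form: for `0 ≤ β₁ < β₂`, `(√β₁)³·Z(β₁) < (√β₂)³·Z(β₂)`. [folklore] -/
theorem scaled_plaquetteMass_SU2_lt {β₁ β₂ : ℝ} (h₁ : 0 ≤ β₁) (h : β₁ < β₂) :
    Real.sqrt β₁ ^ 3 * ∫ U, Real.exp (-(β₁ * (Matrix.trace (1 - (U : Matrix (Fin 2) (Fin 2) ℂ))).re)) ∂(haarProbability (Matrix.specialUnitaryGroup (Fin 2) ℂ))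
      < Real.sqrt β₂ ^ 3 * ∫ U, Real.exp (-(β₂ * (Matrix.trace (1 - (U : Matrix (Fin 2) (Fin 2) ℂ))).re)) ∂(haarProbability (Matrix.specialUnitaryGroup (Fin 2) ℂ)) :=
  scaled_plaquetteMass_SU2_strictMonoOn (Set.mem_Ici.2 h₁) (Set.mem_Ici.2 (h₁.trans h.le)) h

/-! ### §7 The tangent floor `Z(β) ≥ e^{−2β}` and the floor by value -/
/-- `∫₀^π sin²ψ dψ = π∕2` and `∫₀^π sin²ψ cos ψ dψ = 0` give `∫_{(0,π)} (1 + 2β cos ψ) sin²ψ dψ = π∕2`. [folklore] -/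
theorem integral_tangent_weight (β : ℝ) :
    ∫ ψ in Set.Ioo 0 Real.pi, (1 + 2 * β * Real.cos ψ) * Real.sin ψ ^ 2 = Real.pi / 2 := by
  rw [setIntegral_Ioo_eq_intervalIntegral]
  have h1 : ∫ x in (0 : ℝ)..Real.pi, Real.sin x ^ 2 = Real.pi / 2 := by rw [integral_sin_sq]; simp
  have h2 : ∫ x in (0 : ℝ)..Real.pi, Real.sin x ^ 2 * Real.cos x = 0 := by rw [integral_sin_sq_mul_cos]; simp
  have hi1 : IntervalIntegrable (fun x : ℝ => Real.sin x ^ 2) volume 0 Real.pi := (by fun_prop : Continuous fun x : ℝ => Real.sin x ^ 2).intervalIntegrable _ _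
  have hi2 : IntervalIntegrable (fun x : ℝ => 2 * β * (Real.sin x ^ 2 * Real.cos x)) volume 0 Real.pi :=
    (by fun_prop : Continuous fun x : ℝ => 2 * β * (Real.sin x ^ 2 * Real.cos x)).intervalIntegrable _ _
  have hsplit : ∫ x in (0 : ℝ)..Real.pi, (1 + 2 * β * Real.cos x) * Real.sin x ^ 2
      = ∫ x in (0 : ℝ)..Real.pi, (Real.sin x ^ 2 + 2 * β * (Real.sin x ^ 2 * Real.cos x)) :=
    intervalIntegral.integral_congr fun x _ => by ring
  rw [hsplit, intervalIntegral.integral_add hi1 hi2, intervalIntegral.integral_const_mul, h1, h2]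
  ring
/-- **THE TANGENT FLOOR**: `e^{−2β} ≤ ∫ e^{−β·Re tr(1−U)} dHaar_{SU(2)}(U)` for every `β ≥ 0` — the one-plaquette mass is at least the Boltzmann factor of the
MEAN action `⟨Re tr(1−U)⟩_Haar = 2` (Weyl + the tangent line `e^{2β cos ψ} ≥ 1 + 2β cos ψ`; Jensen's inequality without convexity bookkeeping). [folklore] -/
theorem exp_neg_two_mul_le_plaquetteMass_SU2 {β : ℝ} (hβ : 0 ≤ β) :
    Real.exp (-(2 * β))
      ≤ ∫ U, Real.exp (-(β * (Matrix.trace (1 - (U : Matrix (Fin 2) (Fin 2) ℂ))).re)) ∂(haarProbability (Matrix.specialUnitaryGroup (Fin 2) ℂ)) := by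
  rw [integral_exp_neg_traceDeficit_eq hβ]
  have hIoo : ∀ {g : ℝ → ℝ}, Continuous g → Integrable g (volume.restrict (Set.Ioo 0 Real.pi)) := fun hg =>
    (hg.integrableOn_Icc).mono_set Set.Ioo_subset_Icc_self
  have hpt : ∀ ψ : ℝ, Real.exp (-(2 * β)) * ((1 + 2 * β * Real.cos ψ) * Real.sin ψ ^ 2)
      ≤ Real.exp (-(2 * β * (1 - Real.cos ψ))) * Real.sin ψ ^ 2 := fun ψ => by
    have ht : 2 * β * Real.cos ψ + 1 ≤ Real.exp (2 * β * Real.cos ψ) := Real.add_one_le_exp _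
    have he : Real.exp (-(2 * β * (1 - Real.cos ψ))) = Real.exp (-(2 * β)) * Real.exp (2 * β * Real.cos ψ) := by
      rw [← Real.exp_add]; congr 1; ring
    rw [he]
    have hsin : 0 ≤ Real.sin ψ ^ 2 := sq_nonneg _
    calc Real.exp (-(2 * β)) * ((1 + 2 * β * Real.cos ψ) * Real.sin ψ ^ 2)
        ≤ Real.exp (-(2 * β)) * (Real.exp (2 * β * Real.cos ψ) * Real.sin ψ ^ 2) :=
          mul_le_mul_of_nonneg_left (mul_le_mul_of_nonneg_right (by linarith) hsin) (Real.exp_pos _).le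
      _ = Real.exp (-(2 * β)) * Real.exp (2 * β * Real.cos ψ) * Real.sin ψ ^ 2 := by ring
  have hmono : ∫ ψ in Set.Ioo 0 Real.pi, Real.exp (-(2 * β)) * ((1 + 2 * β * Real.cos ψ) * Real.sin ψ ^ 2)
      ≤ ∫ ψ in Set.Ioo 0 Real.pi, Real.exp (-(2 * β * (1 - Real.cos ψ))) * Real.sin ψ ^ 2 :=
    integral_mono (hIoo (by fun_prop)) (hIoo (by fun_prop)) hpt
  rw [integral_const_mul, integral_tangent_weight] at hmono
  have hπ := Real.pi_pos
  calc Real.exp (-(2 * β)) = 2 / Real.pi * (Real.exp (-(2 * β)) * (Real.pi / 2)) := by field_simp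
    _ ≤ 2 / Real.pi * ∫ ψ in Set.Ioo 0 Real.pi, Real.exp (-(2 * β * (1 - Real.cos ψ))) * Real.sin ψ ^ 2 :=
        mul_le_mul_of_nonneg_left hmono (by positivity)
/-- **THE FLOOR BY VALUE FROM THE SMALL-β END**: for `β ≥ 3∕4`, `(3√3∕8)·e^{−3∕2}·((√β)⁻¹)³ ≤ ∫ e^{−β·Re tr(1−U)} dHaar_{SU(2)}(U)`
(`f(β) ≥ f(3∕4) ≥ (√(3∕4))³·e^{−3∕2}` by §6 + the tangent floor; `0.14493·β^{−3∕2}` against V41's Markov floor `e⁻¹∕8 = 0.04599` and the truth `(2√π)⁻¹ = 0.28209`;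
`β₀ = 3∕4` maximises `β₀^{3∕2}e^{−2β₀}`). [folklore] -/
theorem tangentFloor_le_plaquetteMass_SU2 {β : ℝ} (hβ : 3 / 4 ≤ β) :
    3 * Real.sqrt 3 / 8 * Real.exp (-(3 / 2)) * ((Real.sqrt β)⁻¹) ^ 3
      ≤ ∫ U, Real.exp (-(β * (Matrix.trace (1 - (U : Matrix (Fin 2) (Fin 2) ℂ))).re)) ∂(haarProbability (Matrix.specialUnitaryGroup (Fin 2) ℂ)) := by
  have hβ0 : 0 < β := by linarith
  have hsβ : 0 < Real.sqrt β := Real.sqrt_pos.2 hβ0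
  have hmono := scaled_plaquetteMass_SU2_le (by norm_num : (0 : ℝ) ≤ 3 / 4) hβ
  have hfl := exp_neg_two_mul_le_plaquetteMass_SU2 (by norm_num : (0 : ℝ) ≤ 3 / 4)
  have hs34 : Real.sqrt (3 / 4) ^ 3 = 3 * Real.sqrt 3 / 8 := by
    have h4 : Real.sqrt (3 / 4) = Real.sqrt 3 / 2 := by
      rw [show (3 : ℝ) / 4 = 3 / 2 ^ 2 by norm_num, Real.sqrt_div (by norm_num : (0:ℝ) ≤ 3), Real.sqrt_sq (by norm_num : (0:ℝ) ≤ 2)]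
    rw [h4, div_pow, pow_succ, Real.sq_sqrt (by norm_num : (0:ℝ) ≤ 3)]
    ring
  have hfl' : Real.exp (-(3 / 2))
      ≤ ∫ U, Real.exp (-(3 / 4 * (Matrix.trace (1 - (U : Matrix (Fin 2) (Fin 2) ℂ))).re)) ∂(haarProbability (Matrix.specialUnitaryGroup (Fin 2) ℂ)) := by
    have e : (-(3 / 2) : ℝ) = -(2 * (3 / 4)) := by norm_num
    rw [e]; exact hfl
  -- `(3√3/8)·e^{−3/2} ≤ (3√3/8)·Z(3/4) ≤ (√β)³·Z(β)`
  have hstep : 3 * Real.sqrt 3 / 8 * Real.exp (-(3 / 2))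
      ≤ Real.sqrt β ^ 3 * ∫ U, Real.exp (-(β * (Matrix.trace (1 - (U : Matrix (Fin 2) (Fin 2) ℂ))).re)) ∂(haarProbability (Matrix.specialUnitaryGroup (Fin 2) ℂ)) := by
    rw [← hs34]
    exact (mul_le_mul_of_nonneg_left hfl' (by positivity)).trans hmono
  rw [inv_pow, ← div_eq_mul_inv, div_le_iff₀ (pow_pos hsβ 3)]
  linarith
/-! ### §8 The mean action under the one-plaquette Wilson weight is below equipartition -/
/-- Weyl form of the first moment: for `β ≥ 0`, `∫ Re tr(1−U)·e^{−β·Re tr(1−U)} dHaar_{SU(2)}(U) = (2∕π)·∫_{(0,π)} 2(1 − cos ψ)·e^{−2β(1−cos ψ)} sin²ψ dψ`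
(V40e's class-function formula with `φ(x) = (2 − x)⁺·e^{−β(2−x)}`). [folklore] -/
theorem integral_traceDeficit_mul_exp_eq {β : ℝ} (hβ : 0 ≤ β) :
    ∫ U, (Matrix.trace (1 - (U : Matrix (Fin 2) (Fin 2) ℂ))).re * Real.exp (-(β * (Matrix.trace (1 - (U : Matrix (Fin 2) (Fin 2) ℂ))).re))
        ∂(haarProbability (Matrix.specialUnitaryGroup (Fin 2) ℂ))
      = 2 / Real.pi * ∫ ψ in Set.Ioo 0 Real.pi, 2 * (1 - Real.cos ψ) * Real.exp (-(2 * β * (1 - Real.cos ψ))) * Real.sin ψ ^ 2 := by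
  have hφm : Measurable fun x : ℝ => max (2 - x) 0 * Real.exp (-(β * (2 - x))) :=
    ((continuous_const.sub continuous_id).max continuous_const).measurable.mul (Real.continuous_exp.comp ((continuous_const.mul (continuous_const.sub continuous_id)).neg)).measurable
  have hφ0 : ∀ x : ℝ, 0 ≤ max (2 - x) 0 * Real.exp (-(β * (2 - x))) := fun x => mul_nonneg (le_max_right _ _) (Real.exp_pos _).le
  have hφM : ∀ x : ℝ, -2 ≤ x → x ≤ 2 → max (2 - x) 0 * Real.exp (-(β * (2 - x))) ≤ 4 := fun x hx1 hx2 => by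
    have h1 : max (2 - x) 0 ≤ 4 := max_le (by linarith) (by norm_num)
    have h2 : Real.exp (-(β * (2 - x))) ≤ 1 := by rw [Real.exp_le_one_iff]; nlinarith
    calc max (2 - x) 0 * Real.exp (-(β * (2 - x))) ≤ 4 * 1 := mul_le_mul h1 h2 (Real.exp_pos _).le (by norm_num)
      _ = 4 := by norm_num
  have h := integral_haar_su2_classFun (fun x : ℝ => max (2 - x) 0 * Real.exp (-(β * (2 - x)))) hφm hφ0 hφM
  have hL : ∀ U : Matrix.specialUnitaryGroup (Fin 2) ℂ,
      max (2 - (Matrix.trace (U : Matrix (Fin 2) (Fin 2) ℂ)).re) 0 * Real.exp (-(β * (2 - (Matrix.trace (U : Matrix (Fin 2) (Fin 2) ℂ)).re)))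
        = (Matrix.trace (1 - (U : Matrix (Fin 2) (Fin 2) ℂ))).re * Real.exp (-(β * (Matrix.trace (1 - (U : Matrix (Fin 2) (Fin 2) ℂ))).re)) := fun U => by
    have hle := (abs_le.1 (abs_re_trace_le_two U)).2
    rw [re_trace_one_sub_eq, max_eq_left (by linarith)]
  have hR : ∀ ψ : ℝ, max (2 - 2 * Real.cos ψ) 0 * Real.exp (-(β * (2 - 2 * Real.cos ψ))) * Real.sin ψ ^ 2
      = 2 * (1 - Real.cos ψ) * Real.exp (-(2 * β * (1 - Real.cos ψ))) * Real.sin ψ ^ 2 := fun ψ => by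
    rw [max_eq_left (by linarith [Real.cos_le_one ψ])]
    congr 2
    · ring
    · congr 1; ring
  simp only [hL] at h
  rw [h]
  congr 1
  exact integral_congr_ae (ae_of_all _ fun ψ => hR ψ)
/-- **THE MEAN ACTION IS STRICTLY BELOW EQUIPARTITION**: for `β > 0`,
`β·∫ Re tr(1−U)·e^{−β·Re tr(1−U)} dHaar_{SU(2)} < (3∕2)·∫ e^{−β·Re tr(1−U)} dHaar_{SU(2)}` — under the one-plaquette Wilson weight `e^{−βs}dHaar∕Z(β)` the mean
action `⟨s⟩_β` is strictly less than its Gaussian equipartition value `dim SU(2)∕(2β) = 3∕(2β)` at every coupling (equivalent to §6's `f′ > 0` via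
`(log Z)′ = −⟨s⟩_β`; the defect is `(1∕(2β))·⟨(1 − cos ψ)²⟩`-shaped, §4). [folklore] -/
theorem mean_action_lt_equipartition {β : ℝ} (hβ : 0 < β) :
    β * ∫ U, (Matrix.trace (1 - (U : Matrix (Fin 2) (Fin 2) ℂ))).re * Real.exp (-(β * (Matrix.trace (1 - (U : Matrix (Fin 2) (Fin 2) ℂ))).re))
        ∂(haarProbability (Matrix.specialUnitaryGroup (Fin 2) ℂ))
      < 3 / 2 * ∫ U, Real.exp (-(β * (Matrix.trace (1 - (U : Matrix (Fin 2) (Fin 2) ℂ))).re)) ∂(haarProbability (Matrix.specialUnitaryGroup (Fin 2) ℂ)) := by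
  have hπ := Real.pi_pos
  rw [integral_traceDeficit_mul_exp_eq hβ.le, integral_exp_neg_traceDeficit_eq hβ.le]
  have hid := weylIntegral_defect_identity β
  have hD := deficitMoment_pos β
  have hneg : ∫ ψ in Set.Ioo 0 Real.pi, 2 * (1 - Real.cos ψ) * Real.exp (-(2 * β * (1 - Real.cos ψ))) * Real.sin ψ ^ 2
      = -(∫ ψ in Set.Ioo 0 Real.pi, -(2 * (1 - Real.cos ψ)) * Real.exp (-(2 * β * (1 - Real.cos ψ))) * Real.sin ψ ^ 2) := by
    rw [← integral_neg]
    exact integral_congr_ae (ae_of_all _ fun ψ => by ring)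
  rw [hneg]
  have key : β * -(∫ ψ in Set.Ioo 0 Real.pi, -(2 * (1 - Real.cos ψ)) * Real.exp (-(2 * β * (1 - Real.cos ψ))) * Real.sin ψ ^ 2)
      < 3 / 2 * ∫ ψ in Set.Ioo 0 Real.pi, Real.exp (-(2 * β * (1 - Real.cos ψ))) * Real.sin ψ ^ 2 := by linarith
  have h2 : 0 < 2 / Real.pi := by positivity
  calc β * (2 / Real.pi * -(∫ ψ in Set.Ioo 0 Real.pi, -(2 * (1 - Real.cos ψ)) * Real.exp (-(2 * β * (1 - Real.cos ψ))) * Real.sin ψ ^ 2))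
      = 2 / Real.pi * (β * -(∫ ψ in Set.Ioo 0 Real.pi, -(2 * (1 - Real.cos ψ)) * Real.exp (-(2 * β * (1 - Real.cos ψ))) * Real.sin ψ ^ 2)) := by ring
    _ < 2 / Real.pi * (3 / 2 * ∫ ψ in Set.Ioo 0 Real.pi, Real.exp (-(2 * β * (1 - Real.cos ψ))) * Real.sin ψ ^ 2) := mul_lt_mul_of_pos_left key h2
    _ = 3 / 2 * (2 / Real.pi * ∫ ψ in Set.Ioo 0 Real.pi, Real.exp (-(2 * β * (1 - Real.cos ψ))) * Real.sin ψ ^ 2) := by ring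

end Summit.QuantumFields.BalabanUV.T4Continuum.NE7b.CompactFibrePlaquetteMassSU2Monotone

end
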